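import Summits.AtomisticToContinuum.Crystallization.Theorems.FrustratedLawDichotomyMotifDoorE
import Summits.AtomisticToContinuum.Crystallization.Theorems.FrustratedLawDichotomyTwoShellRigidityFrames
import Literature.Geometry.DiscreteGeometry.ShellCensusTwelve

/-!
# FrustratedLawDichotomy · crux `AperiodicFrustratedLawGap` (stmt-AtomisticToContinuum-27623) — SHELL FLAG CERTIFICATES, part 2: capped GOODNESS
# `GoodAtScale η D z c` of one site of a finite configuration from RATIONAL fit data — the goodness flag consumed by the periodic-block
# negative kernel `…PeriodicBlockViolation.not_pairLevelLaw_of_cell` (decomp-a2c, prover hand 2, structural share, generation 16; critic row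
# 567 (C)(2); part 1 `…ShellBadnessCert` is the badness certificate)

Format (`goodAtScale_of_fit_fcc` / `_hcp`): `z : Fin M → ℝ³` injective, centre `c`; a nearest neighbour `a₁ ≠ c` (`|z a₁ − z c|² ≤ |z a − z c|²`
for all `a ≠ c`; the fit scale is `d := |z a₁ − z c|`, capped by `d² ≤ D²`); an orthonormal frame `o : Fin 3 → ℝ³` (`⟪o i, o j⟫ = δ_ij` — the
columns of the isometry `A x = Σ_i x_i • o_i`, `exists_isometry_of_frame`); an assignment `τ : Fin 12 → Fin M` of atoms to the pattern tuple
`ShellCensus.fccTuple k = fccVec k/√2` (resp. `hcpTuple k = hcpVec k/√18`); tolerances `0 ≤ η' < η`; a shell margin `0 < g ≤ 13/10`; and,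
with `x_k = z (τ k) − z c`, `q = |z a₁ − z c|²`, `R_k = Σ_i (vec k)_i·⟪x_k, o_i⟫`:
* FIT  `0 ≤ R_k ∧ N·(|x_k|² + q(1 − η'²))² ≤ 4·q·R_k²` (`N = 2` fcc, `18` hcp) — the rationalisation of `‖x_k − √q·A(tuple k)‖ ≤ η'·√q`;
* NEAR `|x_k|² ≤ (13/10 − g)²·q`;   * FAR `(13/10 + g)²·q ≤ |z a − z c|²` for every `a ≠ c` off the image of `τ`.
Then `GoodAtScale η D z c` (witnesses `d = √q`, `γ = g·√q`, `t u = z (τ k(u))`).  All `[folklore]`; 0 sorry; no definitions.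
-/

noncomputable section

namespace Summit.AtomisticToContinuum.Crystallization.Theorems.FrustratedLawDichotomyShellGoodnessCert

open scoped BigOperators RealInnerProductSpace
open Literature.Geometry.DiscreteGeometry
open Literature.Geometry.DiscreteGeometry.ShellCensus (fccVec hcpVec fccTuple hcpTuple image_fccTuple image_hcpTuple fccTuple_injective
  hcpTuple_injective)
open Summit.AtomisticToContinuum.Crystallization.Theorems.ChargedEnergyGapNegative (E3)
open Summit.AtomisticToContinuum.Crystallization.Theorems.FrustratedLawDichotomyMotifLemmas (GoodAtScale)
open Summit.AtomisticToContinuum.Crystallization.Theorems.FrustratedLawDichotomyMotifDoorE (MaybeGoodAt)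

/-! ## The GOODNESS certificate (rational fit data ⟹ `GoodAtScale η D`) -/

section Goodness

variable {M : ℕ} {z : Fin M → E3} {c : Fin M}

/-- The linear isometry with prescribed orthonormal columns: `A x = Σ_i x_i • o_i`. [folklore] -/
theorem exists_isometry_of_frame {o : Fin 3 → E3} (ho : ∀ i j, ⟪o i, o j⟫ = if i = j then (1 : ℝ) else 0) :
    ∃ A : E3 →ₗᵢ[ℝ] E3, ∀ x : E3, A x = ∑ i, x i • o i := by
  classical
  have hon : Orthonormal ℝ o := orthonormal_iff_ite.2 ho
  have hcard : Fintype.card (Fin 3) = Module.finrank ℝ E3 := by simp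
  let bo : OrthonormalBasis (Fin 3) ℝ E3 :=
    OrthonormalBasis.mk hon (by rw [hon.linearIndependent.span_eq_top_of_card_eq_finrank hcard])
  let bs : OrthonormalBasis (Fin 3) ℝ E3 := EuclideanSpace.basisFun (Fin 3) ℝ
  refine ⟨(bs.repr.trans bo.repr.symm).toLinearIsometry, fun x => ?_⟩
  show bo.repr.symm (bs.repr x) = _
  rw [← bo.sum_repr_symm]
  refine Finset.sum_congr rfl fun i _ => ?_
  rw [OrthonormalBasis.coe_mk, EuclideanSpace.basisFun_repr]

/-- GOODNESS core (pattern `Pat` enumerated by `tuple k = (vec k)/√N`, unit vectors): the rationalised fit data produce the branch clauses of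
`GoodAtScale` with `d := |z a₁ − z c|`, `γ := g·d`, `t u := z (τ k(u))`. [folklore] -/
theorem fit_core {Pat : Finset E3} {N : ℕ} (hN : N ≠ 0) {vec : Fin 12 → Fin 3 → ℤ} {tuple : Fin 12 → E3}
    (htuple : ∀ k, tuple k = (Real.sqrt N)⁻¹ • intVec (vec k)) (himage : Finset.univ.image tuple = Pat)
    (hinj : Function.Injective tuple) (hPatn : ∀ u ∈ Pat, ‖u‖ = 1)
    (hz : Function.Injective z) {a₁ : Fin M} (ha₁ : a₁ ≠ c) (hmin : ∀ a, a ≠ c → dist (z a₁) (z c) ^ 2 ≤ dist (z a) (z c) ^ 2)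
    {o : Fin 3 → E3} (ho : ∀ i j, ⟪o i, o j⟫ = if i = j then (1 : ℝ) else 0) (τ : Fin 12 → Fin M)
    {η η' g : ℝ} (hη' : η' < η) (hη'0 : 0 ≤ η') (hg : 0 < g) (hg' : g ≤ 13 / 10)
    (hfit : ∀ k, 0 ≤ ∑ i, (vec k i : ℝ) * ⟪z (τ k) - z c, o i⟫ ∧
      (N : ℝ) * (dist (z (τ k)) (z c) ^ 2 + dist (z a₁) (z c) ^ 2 * (1 - η' ^ 2)) ^ 2 ≤
        4 * dist (z a₁) (z c) ^ 2 * (∑ i, (vec k i : ℝ) * ⟪z (τ k) - z c, o i⟫) ^ 2)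
    (hnear : ∀ k, dist (z (τ k)) (z c) ^ 2 ≤ (13 / 10 - g) ^ 2 * dist (z a₁) (z c) ^ 2)
    (hfar : ∀ a, a ≠ c → (∀ k, τ k ≠ a) → (13 / 10 + g) ^ 2 * dist (z a₁) (z c) ^ 2 ≤ dist (z a) (z c) ^ 2) :
    ∃ (A : E3 →ₗᵢ[ℝ] E3) (t : ↥Pat → E3), 0 < dist (z a₁) (z c) ∧ 0 < g * dist (z a₁) (z c) ∧ η' < η ∧
      (∀ u : ↥Pat, t u ∈ Set.range z ∧ ‖(t u - z c) - dist (z a₁) (z c) • A (u : E3)‖ ≤ η' * dist (z a₁) (z c)) ∧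
      (∀ s : E3, s ∈ Set.range z → s ≠ z c → dist (z a₁) (z c) ≤ dist s (z c)) ∧
      (∃ s : E3, s ∈ Set.range z ∧ s ≠ z c ∧ dist s (z c) ≤ dist (z a₁) (z c)) ∧
      (∀ s : E3, s ∈ Set.range z → s ≠ z c → dist s (z c) < 13 / 10 * dist (z a₁) (z c) + g * dist (z a₁) (z c) →
        dist s (z c) ≤ 13 / 10 * dist (z a₁) (z c) - g * dist (z a₁) (z c) ∧ s ∈ Set.range t) := by
  classical
  set d : ℝ := dist (z a₁) (z c) with hd_def
  have hd : 0 < d := dist_pos.2 (hz.ne ha₁)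
  obtain ⟨A, hA⟩ := exists_isometry_of_frame ho
  have hmem : ∀ k, tuple k ∈ Pat := fun k => by rw [← himage]; exact Finset.mem_image_of_mem _ (Finset.mem_univ k)
  have hidx : ∀ u : ↥Pat, ∃ k, tuple k = u := fun u => by
    have h : (u : E3) ∈ Finset.univ.image tuple := by rw [himage]; exact u.2
    obtain ⟨k, -, hk⟩ := Finset.mem_image.1 h
    exact ⟨k, hk⟩
  choose kOf hkOf using hidx
  have hsN : 0 < Real.sqrt N := Real.sqrt_pos.2 (by exact_mod_cast Nat.pos_of_ne_zero hN)
  have hsN2 : Real.sqrt N ^ 2 = N := Real.sq_sqrt (Nat.cast_nonneg N)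
  -- the fit at the tuple index `k`
  have hfitk : ∀ k, ‖(z (τ k) - z c) - d • A (tuple k)‖ ≤ η' * d := by
    intro k
    set x : E3 := z (τ k) - z c with hx
    set R : ℝ := ∑ i, (vec k i : ℝ) * ⟪x, o i⟫ with hR
    obtain ⟨hR0, hineq⟩ := hfit k
    have hAu : A (tuple k) = (Real.sqrt N)⁻¹ • ∑ i, (vec k i : ℝ) • o i := by
      rw [hA, htuple, Finset.smul_sum]
      refine Finset.sum_congr rfl fun i _ => ?_
      rw [PiLp.smul_apply, intVec_apply, smul_eq_mul, smul_smul]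
    have hnAu : ‖A (tuple k)‖ = 1 := by rw [A.norm_map]; exact hPatn _ (hmem k)
    have hinner : ⟪x, A (tuple k)⟫ = (Real.sqrt N)⁻¹ * R := by
      rw [hAu, inner_smul_right, inner_sum]
      congr 1
      exact Finset.sum_congr rfl fun i _ => by rw [inner_smul_right]
    have hexp : ‖x - d • A (tuple k)‖ ^ 2 = ‖x‖ ^ 2 - 2 * d * ((Real.sqrt N)⁻¹ * R) + d ^ 2 := by
      rw [norm_sub_sq_real, inner_smul_right, hinner, norm_smul, Real.norm_of_nonneg hd.le, hnAu]
      ring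
    have hxn : ‖x‖ = dist (z (τ k)) (z c) := by rw [hx, dist_eq_norm]
    -- un-square the rational inequality
    have hkey : ‖x‖ ^ 2 + d ^ 2 * (1 - η' ^ 2) ≤ 2 * d * ((Real.sqrt N)⁻¹ * R) := by
      have h1 : (‖x‖ ^ 2 + d ^ 2 * (1 - η' ^ 2)) ^ 2 ≤ (2 * d * ((Real.sqrt N)⁻¹ * R)) ^ 2 := by
        have heq : (2 * d * ((Real.sqrt N)⁻¹ * R)) ^ 2 = 4 * d ^ 2 * R ^ 2 / N := by
          field_simp
          rw [hsN2]
          ring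
        rw [heq, le_div_iff₀ (by exact_mod_cast Nat.pos_of_ne_zero hN), hxn]
        linarith
      have h2 : 0 ≤ 2 * d * ((Real.sqrt N)⁻¹ * R) := by positivity
      exact (le_abs_self _).trans (abs_le_of_sq_le_sq h1 h2)
    have hsq : ‖x - d • A (tuple k)‖ ^ 2 ≤ (η' * d) ^ 2 := by rw [hexp]; nlinarith
    exact (pow_le_pow_iff_left₀ (norm_nonneg _) (by positivity) two_ne_zero).1 hsq
  refine ⟨A, fun u => z (τ (kOf u)), hd, by positivity, hη', fun u => ⟨⟨τ (kOf u), rfl⟩, ?_⟩, ?_, ⟨z a₁, ⟨a₁, rfl⟩, hz.ne ha₁, le_rfl⟩, ?_⟩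
  · rw [← hkOf u]
    exact hfitk (kOf u)
  · rintro s ⟨a, rfl⟩ hne
    have ha : a ≠ c := fun h => hne (by rw [h])
    exact (pow_le_pow_iff_left₀ dist_nonneg dist_nonneg two_ne_zero).1 (hmin a ha)
  · rintro s ⟨a, rfl⟩ hne hlt
    have ha : a ≠ c := fun h => hne (by rw [h])
    by_cases hk : ∃ k, τ k = a
    · obtain ⟨k, hk⟩ := hk
      refine ⟨?_, ⟨tuple k, hmem k⟩, ?_⟩
      · have h0 : (0 : ℝ) ≤ (13 / 10 - g) * d := by nlinarith
        have h1 : dist (z a) (z c) ^ 2 ≤ ((13 / 10 - g) * d) ^ 2 := by rw [mul_pow, ← hk]; exact hnear k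
        have := (pow_le_pow_iff_left₀ dist_nonneg h0 two_ne_zero).1 h1
        linarith
      · show z (τ (kOf ⟨tuple k, hmem k⟩)) = z a
        rw [← hk, hinj (hkOf ⟨tuple k, hmem k⟩)]
    · push Not at hk
      have h0 : (0 : ℝ) ≤ (13 / 10 + g) * d := by positivity
      have h1 : ((13 / 10 + g) * d) ^ 2 ≤ dist (z a) (z c) ^ 2 := by rw [mul_pow]; exact hfar a ha hk
      have := (pow_le_pow_iff_left₀ h0 dist_nonneg two_ne_zero).1 h1
      exfalso
      linarith

/-- ★★ **GOODNESS CERTIFICATE, fcc** — `GoodAtScale η D z c` from rational data: `z` injective; a nearest neighbour `a₁ ≠ c` of the centre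
(`|z a₁ − z c|² ≤ |z a − z c|²` for all `a ≠ c`, and `|z a₁ − z c|² ≤ D²`, `0 ≤ D`); an orthonormal frame `o` (`⟪o i, o j⟫ = δ_ij`, the columns of
the isometry); an assignment `τ : Fin 12 → Fin M` (`τ k` = the atom fitting `fccTuple k = fccVec k/√2`); tolerances `0 ≤ η' < η`, margin
`0 < g ≤ 13/10`; and, with `x_k = z (τ k) − z c`, `R_k = Σ_i (fccVec k)_i·⟪x_k, o i⟫`, `q = |z a₁ − z c|²`:
FIT `0 ≤ R_k ∧ 2·(|x_k|² + q(1 − η'²))² ≤ 4·q·R_k²` (⟺ `‖x_k − √q·A(fccTuple k)‖ ≤ η'·√q`), NEAR `|x_k|² ≤ (13/10 − g)²·q`, FAR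
`(13/10 + g)²·q ≤ |z a − z c|²` for every `a ≠ c` off the image of `τ`. [folklore] -/
theorem goodAtScale_of_fit_fcc (hz : Function.Injective z) {a₁ : Fin M} (ha₁ : a₁ ≠ c)
    (hmin : ∀ a, a ≠ c → dist (z a₁) (z c) ^ 2 ≤ dist (z a) (z c) ^ 2) {D : ℝ} (hD0 : 0 ≤ D) (hD : dist (z a₁) (z c) ^ 2 ≤ D ^ 2)
    {o : Fin 3 → E3} (ho : ∀ i j, ⟪o i, o j⟫ = if i = j then (1 : ℝ) else 0) (τ : Fin 12 → Fin M)
    {η η' g : ℝ} (hη' : η' < η) (hη'0 : 0 ≤ η') (hg : 0 < g) (hg' : g ≤ 13 / 10)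
    (hfit : ∀ k, 0 ≤ ∑ i, (fccVec k i : ℝ) * ⟪z (τ k) - z c, o i⟫ ∧
      (2 : ℝ) * (dist (z (τ k)) (z c) ^ 2 + dist (z a₁) (z c) ^ 2 * (1 - η' ^ 2)) ^ 2 ≤
        4 * dist (z a₁) (z c) ^ 2 * (∑ i, (fccVec k i : ℝ) * ⟪z (τ k) - z c, o i⟫) ^ 2)
    (hnear : ∀ k, dist (z (τ k)) (z c) ^ 2 ≤ (13 / 10 - g) ^ 2 * dist (z a₁) (z c) ^ 2)
    (hfar : ∀ a, a ≠ c → (∀ k, τ k ≠ a) → (13 / 10 + g) ^ 2 * dist (z a₁) (z c) ^ 2 ≤ dist (z a) (z c) ^ 2) :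
    GoodAtScale η D z c := by
  obtain ⟨A, t, hd, hγ, hη, ht, h1, h2, hgap⟩ := fit_core (Pat := fccKissingPattern) (N := 2) two_ne_zero (vec := fccVec)
    (tuple := fccTuple) (fun k => rfl) image_fccTuple fccTuple_injective (fun u hu => norm_eq_one_of_mem_fccKissingPattern hu) hz ha₁ hmin
    ho τ hη' hη'0 hg hg' (by exact_mod_cast hfit) hnear hfar
  exact ⟨dist (z a₁) (z c), η', g * dist (z a₁) (z c), A, (pow_le_pow_iff_left₀ dist_nonneg hD0 two_ne_zero).1 hD,
    Or.inl ⟨t, hd, hγ, hη, ht, h1, h2, hgap⟩⟩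

/-- ★★ **GOODNESS CERTIFICATE, hcp** — as `goodAtScale_of_fit_fcc` with `hcpTuple k = hcpVec k/√18`: FIT
`0 ≤ R_k ∧ 18·(|x_k|² + q(1 − η'²))² ≤ 4·q·R_k²`, `R_k = Σ_i (hcpVec k)_i·⟪x_k, o i⟫`. [folklore] -/
theorem goodAtScale_of_fit_hcp (hz : Function.Injective z) {a₁ : Fin M} (ha₁ : a₁ ≠ c)
    (hmin : ∀ a, a ≠ c → dist (z a₁) (z c) ^ 2 ≤ dist (z a) (z c) ^ 2) {D : ℝ} (hD0 : 0 ≤ D) (hD : dist (z a₁) (z c) ^ 2 ≤ D ^ 2)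
    {o : Fin 3 → E3} (ho : ∀ i j, ⟪o i, o j⟫ = if i = j then (1 : ℝ) else 0) (τ : Fin 12 → Fin M)
    {η η' g : ℝ} (hη' : η' < η) (hη'0 : 0 ≤ η') (hg : 0 < g) (hg' : g ≤ 13 / 10)
    (hfit : ∀ k, 0 ≤ ∑ i, (hcpVec k i : ℝ) * ⟪z (τ k) - z c, o i⟫ ∧
      (18 : ℝ) * (dist (z (τ k)) (z c) ^ 2 + dist (z a₁) (z c) ^ 2 * (1 - η' ^ 2)) ^ 2 ≤
        4 * dist (z a₁) (z c) ^ 2 * (∑ i, (hcpVec k i : ℝ) * ⟪z (τ k) - z c, o i⟫) ^ 2)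
    (hnear : ∀ k, dist (z (τ k)) (z c) ^ 2 ≤ (13 / 10 - g) ^ 2 * dist (z a₁) (z c) ^ 2)
    (hfar : ∀ a, a ≠ c → (∀ k, τ k ≠ a) → (13 / 10 + g) ^ 2 * dist (z a₁) (z c) ^ 2 ≤ dist (z a) (z c) ^ 2) :
    GoodAtScale η D z c := by
  obtain ⟨A, t, hd, hγ, hη, ht, h1, h2, hgap⟩ := fit_core (Pat := hcpKissingPattern) (N := 18) (by norm_num) (vec := hcpVec)
    (tuple := hcpTuple) (fun k => rfl) image_hcpTuple hcpTuple_injective (fun u hu => norm_eq_one_of_mem_hcpKissingPattern hu) hz ha₁ hmin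
    ho τ hη' hη'0 hg hg' (by exact_mod_cast hfit) hnear hfar
  exact ⟨dist (z a₁) (z c), η', g * dist (z a₁) (z c), A, (pow_le_pow_iff_left₀ dist_nonneg hD0 two_ne_zero).1 hD,
    Or.inr ⟨t, hd, hγ, hη, ht, h1, h2, hgap⟩⟩

/-- The capped-goodness flag also yields `MaybeGoodAt` (first disjunct). [folklore] -/
theorem maybeGoodAt_of_goodAtScale {η D : ℝ} (h : GoodAtScale η D z c) : MaybeGoodAt η D z c := Or.inl h

end Goodness

end Summit.AtomisticToContinuum.Crystallization.Theorems.FrustratedLawDichotomyShellGoodnessCert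

end
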